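import Summits.ResolutionOfSingularities.ResolutionOfSingularities.Theorems.TightCutCharts
import HarnessLib

/-!
# TightCutCharts2 — decomp-res node «TightCut» (lens-3 g17), tree file 4/7: §J₂.6 (second half) — the
remaining charts and **LAW J₂**
(`TightRepeat.*`: after a tight untranslated repeat on a shade-3 plateau the next move re-blows the same chart
translated along BOTH other
variables).  PROVED, 0 sorry.

Content VERBATIM from the decomp-res lens-3 g17 file `HOME/decomp-res-lens-3/g17/TightCut.lean` (sha256
7fe2fb69bd2eaf82, 3149 l;
HOME = run/shared/lean/pub/decomp-res).  Critic: CRITIC-LEDGER row 136 CLEARED, landing order 2026-08-30T19:49:35Z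
(after node «ShadeCut» =
`Theorems/ShadeCutLawJ`, `ShadeCutTailTwo`, `ShadeCutShadeTwo`, `MaxContactCutShadeCut`).

[WRITER NOTE (decomp-res writer g7): the lens's carried VERBATIM copies §V1/§V2 (g15 ConeCut calculus),
§J/§S/§K/§L/§M (g16 ShadeCut) are
DELETED in favour of the landed `Theorems/ConeCut*`, `ConeCutAxisLaw`, `FloorCutFloor`, `ShadeCut*`,
`MaxContactCutShadeCut` (imported and
opened; `exists_third`/`exists_ne` now the tree's `ConeCut.exists_third` / `FloorCut.exists_ne`); the by-name
`closes` re-export (§M) is not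
restated; g16's `fin3_enum` (dedup of a Literature triviality) becomes a proof-local `have … := by decide` in `prod_three`.  NEW content only, split by the lens's own sections (400-line file limit): `TightCutLawJ2` (§J₂.1–§J₂.3), `TightCutWitness`
(§J₂.4–§J₂.5), `TightCutCharts` + `TightCutCharts2` (§J₂.6), `TightCutPoverty` (§P), `TightCutClasses`
(cone-free: the two §K3 classes, home of
the aside), `MaxContactCutTightCut` (Theses cone: §K3 theorems + §L4 + §N).  ONE namespace `…Theorems.TightCut`
as in the lens; global
`set_option` line dropped; nothing else changed.]
(Sources: CossartPiltant2008 Prop. 4.2; CossartPiltant2009; CossartJannsenSaito2020; Hauser2010; Moh1987;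
HauserPerlega2019; BenitoVillamayor2012; Cutkosky2009 Thm. 5.1.)
-/

noncomputable section

open MvPolynomial Finset
open Literature.AlgebraicGeometry.Resolution
open Literature.AlgebraicGeometry.Resolution.Hauser2010
open Literature.AlgebraicGeometry.Resolution.PointBlowup
open Summit.ResolutionOfSingularities.ResolutionOfSingularities.Theses
open Summit.ResolutionOfSingularities.ResolutionOfSingularities.Theorems.TightDefectClasses
open Summit.ResolutionOfSingularities.ResolutionOfSingularities.Theorems.TightDefectStrongWalks
open Summit.ResolutionOfSingularities.ResolutionOfSingularities.Theorems.ItineraryCutClasses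
open Summit.ResolutionOfSingularities.ResolutionOfSingularities.Theorems.BoundaryLedger
open Summit.ResolutionOfSingularities.ResolutionOfSingularities.Theorems.ProximityCut
open Summit.ResolutionOfSingularities.ResolutionOfSingularities.Theorems.ConeCutAxisLaw
open Literature.AlgebraicGeometry.Resolution.WeightedBlowup
open Literature.Barriers.ResolutionOfSingularities
open Summit.ResolutionOfSingularities.ResolutionOfSingularities.Theorems.FloorCut
open Summit.ResolutionOfSingularities.ResolutionOfSingularities.Theorems.ConeCut
open Summit.ResolutionOfSingularities.ResolutionOfSingularities.Theorems.ExitLaw (fin3_cases)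
open Summit.ResolutionOfSingularities.ResolutionOfSingularities.Theorems.ShadeCut

namespace Summit.ResolutionOfSingularities.ResolutionOfSingularities.Theorems.TightCut

section LawJ2Charts2

variable {K : Type} [Field K] [DecidableEq K] {q : ℕ} {s₀ : State (Fin 3) K}

namespace TightRepeat

variable {W : ForcedWalk q s₀} {t : ℕ} {k : Fin 3}

/-- CHART `k`, untranslated along `u_{j_t}`: the witness `u_k^3` becomes the CONSTANT term of the cubic form
`N_{t+2}` (all other exponents of `R` carry `u_{j_t}` and die at `b_{j_t} = 0`). [new] [folklore] -/
theorem chart_k_bj0_false (hroot : IsRoot q s₀) (h : TightRepeat W t k) (hl : W.j (t + 2) = k)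
    (hbj : W.b (t + 2) (W.j t) = 0) : False := by
  classical
  obtain ⟨o₀, o₁, o₂, ho₀, ho₁, ho₂, -⟩ := h.orders hroot
  set R := resLayer (W.j (t + 2)) (W.st (t + 2)) o₂ with hR
  have hN : coeff (0 : Fin 3 →₀ ℕ) (resForm W (t + 2) o₂) = 0 :=
    (h.cone₂ hroot ho₂).coeff_eq_zero (by rw [map_zero]; decide)
  have hw : coeff (0 : Fin 3 →₀ ℕ) R ≠ 0 := by
    have hupd : (Finsupp.single k 3).update (W.j (t + 2)) 0 = 0 := by
      ext x
      rw [update_apply', hl, Finsupp.zero_apply]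
      split_ifs with hx
      · rfl
      · rw [Finsupp.single_eq_of_ne hx]
    rw [hR, ← hupd, h.coeff_res hroot ho₂ _ (by rw [Finsupp.degree_single])]
    exact h.cubic_witness₂ hroot
  have hN' : coeff (0 : Fin 3 →₀ ℕ) (translate (W.b (t + 2)) R) = 0 := hN
  rw [coeff_translate_eq_sum, Finset.sum_eq_single (0 : Fin 3 →₀ ℕ)] at hN'
  · refine (mul_ne_zero hw ?_) hN'
    rw [Finset.prod_eq_one]
    · exact one_ne_zero
    · intro x _
      simp only [Finsupp.coe_zero, Pi.zero_apply, Nat.choose_zero_right, Nat.cast_one, one_mul, Nat.sub_zero,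
        pow_zero]
  · intro E hE hne
    obtain ⟨hEl, hEd, hface⟩ := h.res_support hroot ho₂ hE
    rw [hl] at hEl hface
    by_cases hEj : E (W.j t) = 0
    · exfalso
      have hf := hface (by rw [Finsupp.add_apply, hEj, Finsupp.single_eq_of_ne h.kj.symm]; rfl)
      apply hne
      ext x
      rcases fin3_cases h.ne h.ki h.kj x with hx | hx | hx <;> rw [hx, Finsupp.zero_apply]
      · have h1 := congrArg (fun f : Fin 3 →₀ ℕ => f (W.j (t + 1))) hf
        simp only [Finsupp.add_apply, Finsupp.single_eq_of_ne h.ki.symm, add_zero] at h1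
        exact h1
      · exact hEj
      · exact hEl
    · rw [Finset.prod_eq_zero (Finset.mem_univ (W.j t))]
      · rw [mul_zero]
      · rw [Finsupp.zero_apply, Nat.choose_zero_right, Nat.cast_one, one_mul, Nat.sub_zero, hbj, zero_pow hEj]
  · intro hnot
    have h0 : coeff (0 : Fin 3 →₀ ℕ) R = 0 := by rwa [mem_support_iff, not_not] at hnot
    rw [h0, zero_mul]

/-- CHART `k`, translated along `u_{j_t}`: the witness `u_i^2 u_j` gives `coeff_{u_i^2} N_{t+2} = b_{j_t} · γ ≠ 0`
in degree 2 of the cubic form. [new] [folklore] -/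
theorem chart_k_bj_false (hroot : IsRoot q s₀) (h : TightRepeat W t k) (hl : W.j (t + 2) = k)
    (hbj : W.b (t + 2) (W.j t) ≠ 0) : False := by
  classical
  obtain ⟨o₀, o₁, o₂, ho₀, ho₁, ho₂, -⟩ := h.orders hroot
  set R := resLayer (W.j (t + 2)) (W.st (t + 2)) o₂ with hR
  have hN : coeff (Finsupp.single (W.j (t + 1)) 2) (resForm W (t + 2) o₂) = 0 :=
    (h.cone₂ hroot ho₂).coeff_eq_zero (by rw [Finsupp.degree_single]; decide)
  have hw : coeff (Finsupp.single (W.j (t + 1)) 2 + Finsupp.single (W.j t) 1) R ≠ 0 := by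
    have hupd : (Finsupp.single (W.j (t + 1)) 2 + Finsupp.single (W.j t) 1).update (W.j (t + 2)) 0 =
        Finsupp.single (W.j (t + 1)) 2 + Finsupp.single (W.j t) 1 := by
      ext x
      rw [update_apply', hl]
      split_ifs with hx
      · rw [hx, Finsupp.add_apply, Finsupp.single_eq_of_ne h.ki, Finsupp.single_eq_of_ne h.kj]
        rfl
      · rfl
    rw [hR, ← hupd, h.coeff_res hroot ho₂ _ (by rw [map_add, Finsupp.degree_single, Finsupp.degree_single]),
      ← add_assoc]
    exact h.quartic_witness₂ hroot
  have hN' : coeff (Finsupp.single (W.j (t + 1)) 2) (translate (W.b (t + 2)) R) = 0 := hN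
  rw [coeff_translate_eq_sum,
    Finset.sum_eq_single (Finsupp.single (W.j (t + 1)) 2 + Finsupp.single (W.j t) 1)] at hN'
  · refine (mul_ne_zero hw ?_) hN'
    rw [prod_three h.ne h.ki h.kj]
    simp only [Finsupp.add_apply, Finsupp.single_eq_same, Finsupp.single_eq_of_ne h.ne,
      Finsupp.single_eq_of_ne h.ne.symm, Finsupp.single_eq_of_ne h.ki, Finsupp.single_eq_of_ne h.kj, add_zero,
      zero_add, Nat.choose_self, Nat.choose_zero_right, Nat.sub_self, Nat.sub_zero, Nat.cast_one, one_mul,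
      pow_zero, pow_one, mul_one]
    exact hbj
  · intro E hE hne
    obtain ⟨hEl, hEd, hface⟩ := h.res_support hroot ho₂ hE
    rw [hl] at hEl hface
    by_cases hlt : E (W.j (t + 1)) < 2
    · rw [Finset.prod_eq_zero (Finset.mem_univ (W.j (t + 1)))]
      · rw [mul_zero]
      · rw [Finsupp.single_eq_same, Nat.choose_eq_zero_of_lt hlt, Nat.cast_zero, zero_mul]
    · exfalso
      push Not at hlt
      have hEdeg := degree_eq_three E h.ne h.ki h.kj
      by_cases hEj : E (W.j t) = 0
      · have hf := hface (by rw [Finsupp.add_apply, hEj, Finsupp.single_eq_of_ne h.kj.symm]; rfl)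
        have h1 := congrArg (fun f : Fin 3 →₀ ℕ => f (W.j (t + 1))) hf
        simp only [Finsupp.add_apply, Finsupp.single_eq_of_ne h.ki.symm, add_zero] at h1
        omega
      · apply hne
        ext x
        rcases fin3_cases h.ne h.ki h.kj x with hx | hx | hx <;> rw [hx, Finsupp.add_apply]
        · rw [Finsupp.single_eq_same, Finsupp.single_eq_of_ne h.ne]
          omega
        · rw [Finsupp.single_eq_of_ne h.ne.symm, Finsupp.single_eq_same]
          omega
        · rw [Finsupp.single_eq_of_ne h.ki, Finsupp.single_eq_of_ne h.kj]
          exact hEl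
  · intro hnot
    have h0 : coeff (Finsupp.single (W.j (t + 1)) 2 + Finsupp.single (W.j t) 1) R = 0 := by
      rwa [mem_support_iff, not_not] at hnot
    rw [h0, zero_mul]

/-- CHART `i`, untranslated along `u_{j_t}` (hence translated along `u_k`): the witness `u_k^3` gives the constant
term `b_k^3 · c ≠ 0` of the cubic form. [new] [folklore] -/
theorem chart_i_bj0_false (hroot : IsRoot q s₀) (h : TightRepeat W t k) (hb : W.b (t + 2) ≠ 0)
    (hl : W.j (t + 2) = W.j (t + 1)) (hbj : W.b (t + 2) (W.j t) = 0) : False := by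
  classical
  obtain ⟨o₀, o₁, o₂, ho₀, ho₁, ho₂, -⟩ := h.orders hroot
  have hbk : W.b (t + 2) k ≠ 0 := by
    intro hbk
    apply hb
    funext x
    rcases fin3_cases h.ne h.ki h.kj x with hx | hx | hx <;> rw [hx]
    · rw [← hl]; exact W.onExc (t + 2)
    · exact hbj
    · exact hbk
  set R := resLayer (W.j (t + 2)) (W.st (t + 2)) o₂ with hR
  have hN : coeff (0 : Fin 3 →₀ ℕ) (resForm W (t + 2) o₂) = 0 :=
    (h.cone₂ hroot ho₂).coeff_eq_zero (by rw [map_zero]; decide)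
  have hw : coeff (Finsupp.single k 3) R ≠ 0 := by
    have hupd : (Finsupp.single k 3).update (W.j (t + 2)) 0 = Finsupp.single k 3 := by
      ext x
      rw [update_apply', hl]
      split_ifs with hx
      · rw [hx, Finsupp.single_eq_of_ne h.ki.symm]
      · rfl
    rw [hR, ← hupd, h.coeff_res hroot ho₂ _ (by rw [Finsupp.degree_single])]
    exact h.cubic_witness₂ hroot
  have hN' : coeff (0 : Fin 3 →₀ ℕ) (translate (W.b (t + 2)) R) = 0 := hN
  rw [coeff_translate_eq_sum, Finset.sum_eq_single (Finsupp.single k 3)] at hN'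
  · refine (mul_ne_zero hw ?_) hN'
    rw [prod_three h.ne h.ki h.kj]
    simp only [Finsupp.zero_apply, Finsupp.single_eq_same, Finsupp.single_eq_of_ne h.ki.symm,
      Finsupp.single_eq_of_ne h.kj.symm, Nat.choose_zero_right, Nat.cast_one, one_mul, Nat.sub_zero, pow_zero,
      mul_one]
    exact pow_ne_zero _ hbk
  · intro E hE hne
    obtain ⟨hEl, hEd, hface⟩ := h.res_support hroot ho₂ hE
    rw [hl] at hEl hface
    by_cases hEj : E (W.j t) = 0
    · exfalso
      have hf := hface (by rw [Finsupp.add_apply, hEj, Finsupp.single_eq_of_ne h.ne.symm]; rfl)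
      have h1 := congrArg (fun f : Fin 3 →₀ ℕ => f (W.j (t + 1))) hf
      simp only [Finsupp.add_apply, Finsupp.single_eq_same, Finsupp.single_eq_of_ne h.ki.symm, hEl,
        zero_add] at h1
      apply hne
      rw [← hf, h1, Finsupp.single_zero, add_zero]
    · rw [Finset.prod_eq_zero (Finset.mem_univ (W.j t))]
      · rw [mul_zero]
      · rw [Finsupp.zero_apply, Nat.choose_zero_right, Nat.cast_one, one_mul, Nat.sub_zero, hbj, zero_pow hEj]
  · intro hnot
    have h0 : coeff (Finsupp.single k 3) R = 0 := by rwa [mem_support_iff, not_not] at hnot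
    rw [h0, zero_mul]

/-- CHART `i`, translated along `u_{j_t}` ONLY: translating back, `R = N_{t+2}(u − b)`; the constant term of `R`
vanishes (the cubic face: `u^{r_{t+2}} u_i^3` is not `u^{r_{t+2}} u_k^3`), which kills the `u_j^3`-coefficient `ν`
of the form `N_{t+2}` (`ρ₀ = −b_j^3 ν`), and then the witness coefficient `ρ_{u_j} = 3 b_j^2 ν` of `R` vanishes too
— but it is the quartic witness. [new] [folklore] -/
theorem chart_i_bk0_false (hroot : IsRoot q s₀) (h : TightRepeat W t k) (hl : W.j (t + 2) = W.j (t + 1))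
    (hbj : W.b (t + 2) (W.j t) ≠ 0) (hbk : W.b (t + 2) k = 0) : False := by
  classical
  obtain ⟨o₀, o₁, o₂, ho₀, ho₁, ho₂, -⟩ := h.orders hroot
  obtain ⟨hl0, hl1, hl2, hl3, hl4, hl5, hl6, hl7⟩ := h.ledger hroot ho₀ ho₁ ho₂
  set R := resLayer (W.j (t + 2)) (W.st (t + 2)) o₂ with hR
  set N := resForm W (t + 2) o₂ with hNdef
  have hhom : N.IsHomogeneous 3 := h.cone₂ hroot ho₂
  have hRN : R = translate (fun x => -W.b (t + 2) x) N := by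
    show R = translate _ (translate (W.b (t + 2)) R)
    rw [JumpCut.translate_translate]
    have h0 : (fun x => W.b (t + 2) x + -W.b (t + 2) x) = (0 : Fin 3 → K) := by
      funext x
      simp
    rw [h0, translate_zero_eq]
  have hsuppN : ∀ E ∈ N.support, E.degree = 3 ∧ E (W.j (t + 2)) = 0 := by
    intro E hE
    have hc := mem_support_iff.mp hE
    refine ⟨?_, ?_⟩
    · by_contra hd
      exact hc (hhom.coeff_eq_zero hd)
    · by_contra hne
      exact hc (coeff_resForm_eq_zero W (t + 2) o₂ hne)
  -- `ρ₀ = 0`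
  have hρ0 : coeff (0 : Fin 3 →₀ ℕ) R = 0 := by
    have hupd : (Finsupp.single (W.j (t + 2)) 3).update (W.j (t + 2)) 0 = 0 := by
      ext x
      rw [update_apply', Finsupp.zero_apply]
      split_ifs with hx
      · rfl
      · rw [Finsupp.single_eq_of_ne hx]
    rw [hR, ← hupd, h.coeff_res hroot ho₂ _ (by rw [Finsupp.degree_single])]
    by_contra hne
    have hf := h.face₂ hroot ho₂ (mem_support_iff.mpr hne) (by rw [map_add, Finsupp.degree_single]; omega)
      (by rw [Finsupp.add_apply, hl, Finsupp.single_eq_of_ne h.ne.symm, add_zero])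
    have h1 := congrArg (fun f : Fin 3 →₀ ℕ => f k) (add_left_cancel hf)
    simp only [hl, Finsupp.single_eq_of_ne h.ki, Finsupp.single_eq_same] at h1
    omega
  -- `ρ₁ ≠ 0`
  have hρ1 : coeff (Finsupp.single (W.j t) 1) R ≠ 0 := by
    have hupd : (Finsupp.single (W.j (t + 1)) 2 + Finsupp.single (W.j t) 1).update (W.j (t + 2)) 0 =
        Finsupp.single (W.j t) 1 := by
      ext x
      rw [update_apply', hl, Finsupp.add_apply]
      split_ifs with hx
      · rw [hx, Finsupp.single_eq_of_ne h.ne]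
      · rw [Finsupp.single_eq_of_ne hx, zero_add]
    rw [hR, ← hupd, h.coeff_res hroot ho₂ _ (by rw [map_add, Finsupp.degree_single, Finsupp.degree_single]),
      ← add_assoc]
    exact h.quartic_witness₂ hroot
  -- both localise at the monomial `u_j^3` of `N`
  have hvan : ∀ D : Fin 3 →₀ ℕ, D k = 0 → ∀ E ∈ N.support, E ≠ Finsupp.single (W.j t) 3 →
      coeff E N * ∏ x, (((E x).choose (D x) : K) * (-W.b (t + 2) x) ^ (E x - D x)) = 0 := by
    intro D hDk E hE hne
    obtain ⟨hEd, hEi⟩ := hsuppN E hE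
    rw [hl] at hEi
    have hEk : E k ≠ 0 := by
      intro hEk
      apply hne
      ext x
      rcases fin3_cases h.ne h.ki h.kj x with hx | hx | hx <;> rw [hx]
      · rw [Finsupp.single_eq_of_ne h.ne]
        exact hEi
      · rw [Finsupp.single_eq_same]
        have := degree_eq_three E h.ne h.ki h.kj
        omega
      · rw [Finsupp.single_eq_of_ne h.kj]
        exact hEk
    rw [Finset.prod_eq_zero (Finset.mem_univ k)]
    · rw [mul_zero]
    · rw [hDk, Nat.choose_zero_right, Nat.cast_one, one_mul, Nat.sub_zero, hbk, neg_zero, zero_pow hEk]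
  have hν : coeff (Finsupp.single (W.j t) 3) N = 0 := by
    have hρ0' := hρ0
    rw [hRN, coeff_translate_eq_sum, Finset.sum_eq_single (Finsupp.single (W.j t) 3)] at hρ0'
    · rw [prod_three h.ne h.ki h.kj] at hρ0'
      simp only [Finsupp.zero_apply, Finsupp.single_eq_same, Finsupp.single_eq_of_ne h.ne,
        Finsupp.single_eq_of_ne h.kj, Nat.choose_zero_right, Nat.cast_one, one_mul, Nat.sub_zero, pow_zero,
        mul_one] at hρ0'
      rcases mul_eq_zero.mp hρ0' with h0 | h0
      · exact h0
      · exact absurd h0 (pow_ne_zero _ (neg_ne_zero.mpr hbj))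
    · exact fun E hE hne => hvan 0 (by rw [Finsupp.zero_apply]) E hE hne
    · intro hnot
      have h0 : coeff (Finsupp.single (W.j t) 3) N = 0 := by rwa [mem_support_iff, not_not] at hnot
      rw [h0, zero_mul]
  apply hρ1
  rw [hRN, coeff_translate_eq_sum, Finset.sum_eq_single (Finsupp.single (W.j t) 3)]
  · rw [hν, zero_mul]
  · exact fun E hE hne => hvan _ (by rw [Finsupp.single_eq_of_ne h.kj]) E hE hne
  · intro hnot
    have h0 : coeff (Finsupp.single (W.j t) 3) N = 0 := by rwa [mem_support_iff, not_not] at hnot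
    rw [h0, zero_mul]

/-- **LAW J₂ — THE TIGHT CORNER LAW (PROVED).**  After a tight untranslated repeat on a shade-3 plateau the next
move is FORCED: it re-blows the chart `u_i` of the repeat, translated along BOTH `u_{j_t}` and `u_k`. [new] [folklore] -/
theorem escape (hroot : IsRoot q s₀) (h : TightRepeat W t k) :
    W.j (t + 2) = W.j (t + 1) ∧ W.b (t + 2) (W.j t) ≠ 0 ∧ W.b (t + 2) k ≠ 0 := by
  have hb : W.b (t + 2) ≠ 0 := fun hb => h.untranslated_false hroot hb
  rcases fin3_cases h.ne h.ki h.kj (W.j (t + 2)) with hl | hl | hl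
  · by_cases hbj : W.b (t + 2) (W.j t) = 0
    · exact (h.chart_i_bj0_false hroot hb hl hbj).elim
    by_cases hbk : W.b (t + 2) k = 0
    · exact (h.chart_i_bk0_false hroot hl hbj hbk).elim
    exact ⟨hl, hbj, hbk⟩
  · exact (h.chart_j_false hroot hl).elim
  · by_cases hbj : W.b (t + 2) (W.j t) = 0
    · exact (h.chart_k_bj0_false hroot hl hbj).elim
    · exact (h.chart_k_bj_false hroot hl hbj).elim

end TightRepeat

end LawJ2Charts2

end Summit.ResolutionOfSingularities.ResolutionOfSingularities.Theorems.TightCut
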